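import Mathlib
import HarnessLib
import Literature.Computability.AlgebraicComplexity.MignonRessayreBound

/-!
# Meet-in-the-middle bound for colour-disjoint rectangles (line rank-dehn-ladder, stub `stub_cutLemma`)

Crux `stmt-PneNP-18923` (`Summit.PneNP.PneNP.Theses.CnfIdealGenLength.RankDefectRepresentations`), line
`rank-dehn-ladder`, negative rung N1 (`stub_cutLemma`, OPEN; colour-disjoint "RECT" form of
`Cruxes/RankDefectRepresentations/Lines/rank-dehn-ladder-SA.md`).  Rows `x : ι` and columns `y : ι'` carry cube
colours `row x, col y : Fin n → Bool`; the `j`-th coordinate cut of `R` is `R ∘ 1[row_j ≠ col_j]`, of rank `≤ t`.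

* `rank_le_hybrid_of_colourDisjoint` — if NO row colour equals a column colour, then
  `rank R ≤ (∑_{j<n} min (2^(n-j)) (2^(j+1))) · t`, hence `rank_le_of_colourDisjoint`: `rank R ≤ n · 2^((n+1)/2) · t`.
  The known unconditional constant for such blocks was `2^n − 1` (`…CutLemmaExponential`, first-differing-coordinate
  recursion); polynomial constants are known only for structured colour pairs (`…CutLemmaCharacterCuts`,
  `…CutLemmaFormulaCuts`, `…CutLemmaRankOneCuts`, `…CutLemmaMonotoneCuts`).

METHOD (an OBLIVIOUS partition of unity, the "certificate" route of the lead's notes): with `h` the indicator of the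
column colours and the HYBRID colours `hyb_j(σ, τ) = (τ_0, …, τ_{j-1}, σ_j, …, σ_{n-1})`, the telescoping identity
`∑_j [h(hyb_{j+1}) − h(hyb_j)] = h(τ) − h(σ) = 1` (row colour `σ`, column colour `τ`) writes the all-ones matrix as a sum
of `n` matrices `M_j`, `M_j` supported on the `j`-th cut; so `R = ∑_j (R ∘ 1[cut_j]) ∘ M_j`, and `M_j(x, y)` depends on
the row only through `(row x)_{≥ j}` (at most `2^(n-j)` patterns) and on the column only through `(col y)_{≤ j}` (at most
`2^(j+1)` patterns), so `(R ∘ 1[cut_j]) ∘ M_j` is a sum of that many diagonal sandwiches of the cut: rank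
`≤ min(2^(n-j), 2^(j+1)) · t`.  The same computation with `h` of ordered-branching-program width `w` gives `2w` in place of
`2^{(n+1)/2}`; by the lead-g2 counting theorem (`Lines/rank-dehn-ladder-briefs.md`) no such oblivious certificate can reach
`poly(n)` for random colourings, so this is a baseline, not a route to N1.
HONEST FRAMING: a baseline improvement on one rung (`2^n → n·2^{(n+1)/2}`); the cut lemma, the crux and P ≠ NP are not
touched; F-N2 is a FRONTIER formal rung.
-/

set_option linter.dupNamespace false -- `Summit.PneNP.PneNP.…`: summit = sub-problem name (D-0017)

namespace Summit.PneNP.PneNP.Theorems.CnfIdealGenLengthRankDefectRepresentationsCutLemmaHybridCuts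

open Finset
open Literature.Computability.AlgebraicComplexity (rank_sum_le)

variable {K : Type} [Field K] {n : ℕ} {ι ι' : Type} [Fintype ι] [Fintype ι'] [DecidableEq ι] [DecidableEq ι']

/-! ## Hybrid colours -/

/-- The `j`-th hybrid of two colours is `τ` below `j` and `σ` from `j` on; the `0`-th hybrid is `σ`. -/
theorem hyb_zero (σ τ : Fin n → Bool) : (fun i : Fin n => if (i : ℕ) < 0 then τ i else σ i) = σ := by
  funext i; simp

/-- The `n`-th hybrid is `τ`. -/
theorem hyb_top (σ τ : Fin n → Bool) : (fun i : Fin n => if (i : ℕ) < n then τ i else σ i) = τ := by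
  funext i; simp [i.isLt]

/-- If `σ` and `τ` agree at coordinate `j`, the `j`-th and `(j+1)`-st hybrids coincide. -/
theorem hyb_succ_eq_of_eq (σ τ : Fin n → Bool) (j : Fin n) (h : σ j = τ j) :
    (fun i : Fin n => if (i : ℕ) < (j : ℕ) + 1 then τ i else σ i) =
      (fun i : Fin n => if (i : ℕ) < (j : ℕ) then τ i else σ i) := by
  funext i
  by_cases h1 : (i : ℕ) < (j : ℕ)
  · simp [h1, show (i : ℕ) < (j : ℕ) + 1 by omega]
  · by_cases h2 : (i : ℕ) = (j : ℕ)
    · have hij : i = j := Fin.ext h2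
      subst hij
      simp [h]
    · simp [h1, show ¬ (i : ℕ) < (j : ℕ) + 1 by omega]

/-- The hybrids depend on `σ` only through its coordinates `≥ j` (row key). -/
theorem hyb_rowKey (σ τ : Fin n → Bool) (j k : ℕ) (hk : j ≤ k) :
    (fun i : Fin n => if (i : ℕ) < k then τ i else σ i) =
      (fun i : Fin n => if (i : ℕ) < k then τ i else (fun i' : Fin n => if (i' : ℕ) < j then false else σ i') i) := by
  funext i
  by_cases h1 : (i : ℕ) < k
  · simp [h1]
  · simp [h1, show ¬ (i : ℕ) < j by omega]

/-- The hybrids depend on `τ` only through its coordinates `< k` (column key). -/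
theorem hyb_colKey (σ τ : Fin n → Bool) (j k : ℕ) (hk : k ≤ j + 1) :
    (fun i : Fin n => if (i : ℕ) < k then τ i else σ i) =
      (fun i : Fin n => if (i : ℕ) < k then (fun i' : Fin n => if (i' : ℕ) < j + 1 then τ i' else false) i else σ i) := by
  funext i
  by_cases h1 : (i : ℕ) < k
  · simp [h1, show (i : ℕ) < j + 1 by omega]
  · simp [h1]

/-! ## Counting keys -/

/-- At most `2^(n-j)` row keys: functions vanishing below `j`. -/
theorem card_rowKeys_le (j : ℕ) (hj : j ≤ n) :
    (Finset.univ.filter (fun q : Fin n → Bool => ∀ i : Fin n, (i : ℕ) < j → q i = false)).card ≤ 2 ^ (n - j) := by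
  classical
  have hcard : Fintype.card (Fin (n - j) → Bool) = 2 ^ (n - j) := by simp
  rw [← hcard, ← Finset.card_univ]
  refine Finset.card_le_card_of_injOn (fun q => fun i : Fin (n - j) => q ⟨j + i, by omega⟩) (fun _ _ => by simp) ?_
  intro q hq q' hq' hqq'
  simp only [Finset.coe_filter, Finset.mem_univ, true_and, Set.mem_setOf_eq] at hq hq'
  funext i
  by_cases hi : (i : ℕ) < j
  · rw [hq i hi, hq' i hi]
  · have h := congrFun hqq' ⟨(i : ℕ) - j, by omega⟩
    have hi' : (⟨j + ((i : ℕ) - j), by omega⟩ : Fin n) = i := Fin.ext (by simp; omega)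
    simpa [hi'] using h

/-- At most `2^(j+1)` column keys: functions vanishing above `j`. -/
theorem card_colKeys_le (j : ℕ) (hj : j < n) :
    (Finset.univ.filter (fun p : Fin n → Bool => ∀ i : Fin n, ¬ (i : ℕ) < j + 1 → p i = false)).card ≤ 2 ^ (j + 1) := by
  classical
  have hcard : Fintype.card (Fin (j + 1) → Bool) = 2 ^ (j + 1) := by simp
  rw [← hcard, ← Finset.card_univ]
  refine Finset.card_le_card_of_injOn (fun p => fun i : Fin (j + 1) => p ⟨i, by omega⟩) (fun _ _ => by simp) ?_
  intro p hp p' hp' hpp'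
  simp only [Finset.coe_filter, Finset.mem_univ, true_and, Set.mem_setOf_eq] at hp hp'
  funext i
  by_cases hi : (i : ℕ) < j + 1
  · have h := congrFun hpp' ⟨(i : ℕ), hi⟩
    have hi' : (⟨((⟨(i : ℕ), hi⟩ : Fin (j + 1)) : ℕ), by omega⟩ : Fin n) = i := Fin.ext (by simp)
    simpa [hi'] using h
  · rw [hp i hi, hp' i hi]

/-! ## The bound -/

/-- **Meet-in-the-middle bound (sum form).** For a colour-disjoint block whose coordinate cuts have rank `≤ t`,
`rank R ≤ (∑_{j<n} min(2^(n-j), 2^(j+1))) · t`. -/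
theorem rank_le_hybrid_of_colourDisjoint (row : ι → Fin n → Bool) (col : ι' → Fin n → Bool) (R : Matrix ι ι' K)
    (t : ℕ) (hdis : ∀ x y, row x ≠ col y)
    (hcut : ∀ j : Fin n, (Matrix.of fun x y => if row x j ≠ col y j then R x y else 0).rank ≤ t) :
    R.rank ≤ (∑ j : Fin n, min (2 ^ (n - j)) (2 ^ ((j : ℕ) + 1))) * t := by
  classical
  -- the separator and the hybrid matrices
  let h : (Fin n → Bool) → K := fun σ => if ∃ y, col y = σ then 1 else 0
  have hcol : ∀ y, h (col y) = 1 := fun y => by simp [h]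
  have hrow : ∀ x, h (row x) = 0 := fun x => by
    simp only [h]
    rw [if_neg]
    rintro ⟨y, hy⟩
    exact hdis x y hy.symm
  let H : ℕ → ι → ι' → K := fun j x y => h (fun i : Fin n => if (i : ℕ) < j then col y i else row x i)
  let M : ℕ → Matrix ι ι' K := fun j => Matrix.of fun x y => H (j + 1) x y - H j x y
  let C : Fin n → Matrix ι ι' K := fun j => Matrix.of fun x y => if row x j ≠ col y j then R x y else 0
  -- telescoping: `R = ∑_j C_j ∘ M_j`
  have htel : ∀ x y, ∑ j ∈ Finset.range n, (H (j + 1) x y - H j x y) = 1 := by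
    intro x y
    rw [Finset.sum_range_sub (fun j => H j x y) n]
    simp only [H]
    rw [hyb_top, hyb_zero, hcol, hrow, sub_zero]
  have hsupp : ∀ (j : Fin n) (x : ι) (y : ι'), row x j = col y j → M j x y = 0 := by
    intro j x y hj
    simp only [M, H, Matrix.of_apply]
    rw [hyb_succ_eq_of_eq (row x) (col y) j hj, sub_self]
  have hR : R = ∑ j : Fin n, Matrix.of fun x y => C j x y * M j x y := by
    ext x y
    rw [Matrix.sum_apply]
    have e1 : ∀ j : Fin n, (Matrix.of fun x y => C j x y * M j x y) x y = R x y * (H ((j : ℕ) + 1) x y - H j x y) := by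
      intro j
      simp only [Matrix.of_apply, C]
      by_cases hj : row x j ≠ col y j
      · simp [hj, M]
      · push Not at hj
        rw [if_neg (not_not.mpr hj), hsupp j x y hj, zero_mul]
        simp only [M, Matrix.of_apply] at hsupp ⊢
        rw [hsupp j x y hj, mul_zero]
    simp only [e1, ← Finset.mul_sum]
    rw [Fin.sum_univ_eq_sum_range (fun j => H (j + 1) x y - H j x y) n, htel, mul_one]
  -- each summand is a sum of diagonal sandwiches of the cut, indexed by row keys …
  have hrowside : ∀ j : Fin n, (Matrix.of fun x y => C j x y * M j x y).rank ≤ 2 ^ (n - j) * t := by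
    intro j
    set Q := Finset.univ.filter (fun q : Fin n → Bool => ∀ i : Fin n, (i : ℕ) < (j : ℕ) → q i = false) with hQ
    let key : (Fin n → Bool) → (Fin n → Bool) := fun σ => fun i => if (i : ℕ) < (j : ℕ) then false else σ i
    have hkey : ∀ σ, key σ ∈ Q := fun σ => by
      simp only [hQ, Finset.mem_filter, Finset.mem_univ, true_and, key]
      intro i hi; simp [hi]
    let m : (Fin n → Bool) → ι' → K := fun q y =>
      h (fun i : Fin n => if (i : ℕ) < (j : ℕ) + 1 then col y i else q i) -
        h (fun i : Fin n => if (i : ℕ) < (j : ℕ) then col y i else q i)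
    have hM : ∀ x y, M j x y = m (key (row x)) y := by
      intro x y
      simp only [M, H, m, Matrix.of_apply, key]
      rw [hyb_rowKey (row x) (col y) j ((j : ℕ) + 1) (by omega), hyb_rowKey (row x) (col y) j j le_rfl]
    have hdec : (Matrix.of fun x y => C j x y * M j x y) =
        ∑ q ∈ Q, Matrix.diagonal (fun x => if key (row x) = q then (1 : K) else 0) * C j *
          Matrix.diagonal (fun y => m q y) := by
      ext x y
      rw [Matrix.sum_apply]
      simp only [Matrix.mul_diagonal, Matrix.diagonal_mul, Matrix.of_apply]
      rw [Finset.sum_eq_single (key (row x))]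
      · rw [if_pos rfl, one_mul, hM]
      · intro q _ hq; rw [if_neg (Ne.symm hq)]; simp
      · intro hnot; exact absurd (hkey (row x)) hnot
    rw [hdec]
    refine (rank_sum_le _ _).trans ?_
    refine (Finset.sum_le_card_nsmul Q _ t fun q _ => ?_).trans ?_
    · exact ((Matrix.rank_mul_le_left _ _).trans (Matrix.rank_mul_le_right _ _)).trans (hcut j)
    · rw [smul_eq_mul]
      exact Nat.mul_le_mul_right t (card_rowKeys_le (n := n) j (by omega))
  -- … or by column keys
  have hcolside : ∀ j : Fin n, (Matrix.of fun x y => C j x y * M j x y).rank ≤ 2 ^ ((j : ℕ) + 1) * t := by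
    intro j
    set P := Finset.univ.filter (fun p : Fin n → Bool => ∀ i : Fin n, ¬ (i : ℕ) < (j : ℕ) + 1 → p i = false) with hP
    let key : (Fin n → Bool) → (Fin n → Bool) := fun τ => fun i => if (i : ℕ) < (j : ℕ) + 1 then τ i else false
    have hkey : ∀ τ, key τ ∈ P := fun τ => by
      simp only [hP, Finset.mem_filter, Finset.mem_univ, true_and, key]
      intro i hi; simp [hi]
    let m : ι → (Fin n → Bool) → K := fun x p =>
      h (fun i : Fin n => if (i : ℕ) < (j : ℕ) + 1 then p i else row x i) -
        h (fun i : Fin n => if (i : ℕ) < (j : ℕ) then p i else row x i)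
    have hM : ∀ x y, M j x y = m x (key (col y)) := by
      intro x y
      simp only [M, H, m, Matrix.of_apply, key]
      rw [hyb_colKey (row x) (col y) j ((j : ℕ) + 1) le_rfl, hyb_colKey (row x) (col y) j j (by omega)]
    have hdec : (Matrix.of fun x y => C j x y * M j x y) =
        ∑ p ∈ P, Matrix.diagonal (fun x => m x p) * C j *
          Matrix.diagonal (fun y => if key (col y) = p then (1 : K) else 0) := by
      ext x y
      rw [Matrix.sum_apply]
      simp only [Matrix.mul_diagonal, Matrix.diagonal_mul, Matrix.of_apply]
      rw [Finset.sum_eq_single (key (col y))]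
      · rw [if_pos rfl, mul_one, hM, mul_comm]
      · intro p _ hp; rw [if_neg (Ne.symm hp)]; simp
      · intro hnot; exact absurd (hkey (col y)) hnot
    rw [hdec]
    refine (rank_sum_le _ _).trans ?_
    refine (Finset.sum_le_card_nsmul P _ t fun p _ => ?_).trans ?_
    · exact ((Matrix.rank_mul_le_left _ _).trans (Matrix.rank_mul_le_right _ _)).trans (hcut j)
    · rw [smul_eq_mul]
      exact Nat.mul_le_mul_right t (card_colKeys_le (n := n) j j.isLt)
  -- assemble
  rw [hR]
  refine (rank_sum_le _ _).trans ?_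
  rw [Finset.sum_mul]
  refine Finset.sum_le_sum fun j _ => ?_
  rcases Nat.le_total (2 ^ (n - j)) (2 ^ ((j : ℕ) + 1)) with hle | hle
  · rw [min_eq_left hle]; exact hrowside j
  · rw [min_eq_right hle]; exact hcolside j

/-- `min (2^a) (2^b) ≤ 2^((a+b)/2)`. -/
theorem min_pow_le (a b : ℕ) : min (2 ^ a) (2 ^ b) ≤ 2 ^ ((a + b) / 2) := by
  rcases Nat.le_total a b with h | h
  · exact (min_le_left _ _).trans (Nat.pow_le_pow_right (by norm_num) (by omega))
  · exact (min_le_right _ _).trans (Nat.pow_le_pow_right (by norm_num) (by omega))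

/-- **Meet-in-the-middle bound.** A colour-disjoint block whose `n` coordinate cuts have rank `≤ t` has rank
`≤ n · 2^((n+1)/2) · t` (versus the first-differing-coordinate baseline `(2^n − 1) · t`). -/
theorem rank_le_of_colourDisjoint (row : ι → Fin n → Bool) (col : ι' → Fin n → Bool) (R : Matrix ι ι' K)
    (t : ℕ) (hdis : ∀ x y, row x ≠ col y)
    (hcut : ∀ j : Fin n, (Matrix.of fun x y => if row x j ≠ col y j then R x y else 0).rank ≤ t) :
    R.rank ≤ n * 2 ^ ((n + 1) / 2) * t := by
  refine (rank_le_hybrid_of_colourDisjoint row col R t hdis hcut).trans ?_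
  refine Nat.mul_le_mul_right t ?_
  have hj : ∀ j : Fin n, min (2 ^ (n - j)) (2 ^ ((j : ℕ) + 1)) ≤ 2 ^ ((n + 1) / 2) := by
    intro j
    refine (min_pow_le _ _).trans (le_of_eq ?_)
    congr 1
    have := j.isLt
    omega
  calc ∑ j : Fin n, min (2 ^ (n - j)) (2 ^ ((j : ℕ) + 1)) ≤ ∑ _j : Fin n, 2 ^ ((n + 1) / 2) :=
        Finset.sum_le_sum fun j _ => hj j
    _ = n * 2 ^ ((n + 1) / 2) := by simp

end Summit.PneNP.PneNP.Theorems.CnfIdealGenLengthRankDefectRepresentationsCutLemmaHybridCuts
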